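import Literature.MathematicalPhysics.QuantumFieldTheory.Balaban1983to89.B14Ineq313
import Literature.MathematicalPhysics.QuantumFieldTheory.Balaban1983to89.B7Prop1Local

/-!
# `Balaban1983to89.B14Hyp313Discharge` — T. Bałaban, *Convergent renormalization expansions for lattice gauge
# theories*, Commun. Math. Phys. **119** (1988) 243–285 [Balaban1988Convergent]: (3.12) ⇒ (3.13) p. 267 — the
# plaquette smallness `4(1+β₀)B₃ε_k` of `V^{(k)} = M^k(U_{k+1})`, `V^{(k)}_{□′} = M^k(U_{k+1,□′})` (the hypotheses
# `Hyp313.plaqV/plaqVbox` of `B14Ineq313`) DISCHARGED from the regularity condition (3.12) by Proposition 2 of [12]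
# (tree: `B7Prop2Explicit`, `B7Prop2SpecialUnitary`, `B7Prop1Local`) for the concrete `k`-fold block average (43) of
# [12] on `ℤ^d` (model instance `B7Prop2Explicit.avgIter`)

statement-level skeleton of published theorems with citation tags; proofs where landed; nothing here is a claim
about the Yang–Mills mass gap

PDF held: `paper:balaban1988-cmp119-convergent-renormalization` (journal page = PDF page + 242); pp. 246, 265–267
(PDF 4, 23–25) read from the held text.  "[12]" = T. Bałaban, *Averaging operations for lattice gauge theories*, CMP
**98** (1985) 17–51 [Balaban1985Averaging] (B7), Props. 1–2 pp. 24–26, PROVED in the tree for the concrete average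
(42)/(43) on `ℤ^d` (`B7Prop1Explicit.prop1_explicit`; `B7Prop2Explicit.prop2_explicit`,
`B7Prop2SpecialUnitary.prop2_explicit_at`, with the printed locality `B7Prop1Local.prop2_local_at`).  "[14]" = *Spaces of
regular gauge field configurations …*, CMP **99** (1985) [Balaban1985RegularSpaces] (B8), Lemma 1 (`B8Lemma1NonAbelian`).

WHAT IS REPRODUCED.  SKELETON row `B14.Claim@267` (mega-formalization `lit-balaban`, HOME
`run/shared/lean/pub/lit-balaban/`, Phase-2 proof seat `p29`, unit `lit-balaban-p29`; statement file `B14Ineq313` by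
reader r11, where (3.13) is PROVED as `B14.Ineq313.Ineq313Printed_holds` over the block-pair model `Hyp313` whose
fields `plaqV`, `plaqVbox` — the plaquette variables of `V^{(k)}`, `V^{(k)}_{□′}` are `4(1+β₀)B₃ε_k`-close to `1` — were
HYPOTHESES).  THE PRINTED TEXT (p. 267, verbatim): *"Consider a cube □′ ⊂ Ω_{k+1}. The restrictions on the fields
V_k, V_{k+1} on Ω~_{k+1}, and Theorem 1 from [16] imply, that U_{k+1} satisfies the following regularity condition:
|U_{k+1}(∂p) − 1| < 2B₃L²(1+β₀)ε_k(L⁻¹η)² for p ⊂ □′~. (3.12)  On this cube the configuration U_{k+1,□′} satisfies the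
regularity condition as above, only with the coefficient 1 in front of ε_{k+1}. By the definition of these
configurations, and the constraints on V_k, we have M^{k+1}(U_{k+1}) = V_{k+1} = M^{k+1}(U_{k+1,□′}) on □′~. Applying
Lemma 1 [14] we obtain |V^{(k)} − V^{(k)}_{□′}| < (4dL)²(1+β₀)B₃ε_k on □′~, (3.13)"*, with `V^{(k)} = M^k(U_{k+1})`
((3.10) p. 266), `V^{(k)}_{□′} = M^k(U_{k+1,□′})` ((3.3)–(3.4) p. 265), `M^k` the `k`-fold average (43) of [12] from
`T_η`, `η = L^{−k}`, to the unit lattice `T^{(k)}_1`; cf. p. 246 (the case `k = 1`): *"If a plaquette p′ is contained in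
(P₀^c)^{(1)}, then Proposition 1 [12] implies that the new field V satisfies the bound |V(∂p′) − 1| < 2L²ε₀."*

THE ARGUMENT FORMALISED (the print's tacit step between (3.12) and "Applying Lemma 1 [14]").  (3.12) is the hypothesis
(52) of Prop. 2 of [12], `|U(∂p) − 1| < α₀η²`, `η = L^{−k}`, with `α₀ = 2B₃L²(1+β₀)ε_k·L⁻² = 2(1+β₀)B₃ε_k`
(`bound312_eq`); (54) of [12] gives `|M^k(U)(∂p) − 1| < α₀ + 2C₀α₀² < 2α₀ = 4(1+β₀)B₃ε_k` on the unit `k`-lattice —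
EXACTLY the plaquette constant `4(1+β₀)B₃ε_k = α₀′L⁻²`, `α₀′ = 4L²(1+β₀)B₃ε_k`, at which r11's `ineq313_blockPair`
applies Lemma 1 of [14] to output the printed `(4dL)²(1+β₀)B₃ε_k = 4d²α₀′`.  For `U_{k+1,□′}` ("coefficient 1"):
`α₀ = (1+β₀)B₃ε_k`, output `2(1+β₀)B₃ε_k ≤ 4(1+β₀)B₃ε_k`.  PROVED HERE (kernel; axioms `propext`, `Classical.choice`,
`Quot.sound`; for any gauge group `G ⊂ {|u| ≤ 1, |u⁻¹| ≤ 1}` closed under (42) at a radius `t` — `AvgClosedAt`; `U(N)`: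
`t = 1/4`, `SU(N)`: `Nt < π`): §2 the plaquette smallness of `M^k(U)`; §3 the block `Hyp313` built from (3.12) and
**(3.12) ⇒ (3.13)** through the row's decl `Ineq313Printed`; §4 the same with the printed locality; §5 `U(N)`, `SU(N)`.

MODEL / DECLARED DEVIATIONS (referee columns F6/F7; those of `B14Ineq313` (D1)–(D3) and `B7Prop2Explicit` (b)–(e) are
inherited).  (M1) LATTICE: `T_η`, `η = L^{−k}`, is read on `ℤ^d` (`U(x, κ) = U(⟨ηx, η(x + e_κ)⟩)`, `B7Prop2Explicit`
DICTIONARY); `M^k = avgIter L · k` (each step = (42) followed by `Lℤ^d ≅ ℤ^d`); the unit `k`-lattice plaquettes of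
`M^k(U)` are `hol (avgIter L U k) x (plaqWord μ ν)`.  (M2) LOCALITY: (3.12) is printed "for `p ⊂ □′~`" (`□′~` a
neighbourhood of a big cube of `Ω_{k+1}`, a union of many `L`-blocks); §§2–3 assume it for ALL plaquettes of `ηℤ^d` as
the strict bound `pdev U < …` on the supremum (the form (52) has in `B7Prop2Explicit`); §4 (`ineq313_of_312_local`) only
for the `η`-plaquettes under the `2L`-cube `y + [0, 2L)^d ⊃ B(y) ∪ B(y + Le_κ)` of the unit `k`-lattice
(`B7Prop1Local.pdevOn`; the printed locality of Prop. 2 of [12]) — "on `□′~`" is rendered block pair by block pair.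
(M3) SMALLNESS: print has all constants "for `g_k` [hence `ε_k`] sufficiently small" (p. 246); here explicitly
`0 < (1+β₀)B₃ε_k`, `C₀(d)·2(1+β₀)B₃ε_k ≤ ⅓`, `4(1+β₀)B₃ε_k ≤ c₂′(d, L) = 1/(512(d+1)(d+4)L²)` (= `C₀α₀ ≤ ⅓`, `2α₀ ≤ c₂′`
of Prop. 2 of [12] at `α₀ = 2(1+β₀)B₃ε_k`), for a general `G` the closure radius `64(d+1)(d+4)L²(1+β₀)B₃ε_k ≤ t`, and
`L ≥ 2` ([12] p. 17 "`L > 1`").  (M4) "coefficient 1 in front of ε_{k+1}" (p. 267): (3.12) displays `ε_k`; read `ε_k`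
(r11 ROWS-B14 note T13); the coefficient-`c` form covers both.  (M5) The exact-axial and equal-averages clauses of `Hyp313` stay
hypotheses (the printed inputs "the constraints on V_k" / "M^{k+1}(U_{k+1}) = V_{k+1} = M^{k+1}(U_{k+1,□′})", i.e. the
definitions (3.3), (3.10) of the two minimizers), as does (3.12) itself (from Theorem 1 of [16] = B10, `B10.Thm1`).
Net new unproved facts: 0 (theorems only).
-/

open scoped BigOperators
open NormedSpace Finset

namespace Literature.MathematicalPhysics.QuantumFieldTheory.Balaban1983to89.B14Hyp313Discharge

open B7Prop1Explicit B7Prop2Explicit B7Prop2SpecialUnitary B7Prop1Local MatrixLog B8Lemma1NonAbelian B14.Ineq313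
open B8Lemma1Lattice (InBlock)

-- `Site` alone could resolve to the torus sites of `Setup.lean` through a parent namespace; re-export the `ℤ^d`
-- sites `Fin d → ℤ` of `B7Prop1Explicit` (the convention of `B8Lemma1NonAbelian`, `B14Ineq313`).
export B7Prop1Explicit (Site)

variable {d : ℕ}

/-! ## §1 Bookkeeping: the arithmetic of (3.12) and of the smallness conditions -/

/-- **(3.12) is (52) of [12] with `α₀ = c(1+β₀)B₃ε_k`:** `cB₃L²(1+β₀)ε_k(L⁻¹η)² = c(1+β₀)B₃ε_k·η²`, `η = L^{−k}`
(`c = 2` for `U_{k+1}`, `c = 1` for `U_{k+1,□′}`). [cite: Balaban1988Convergent, (3.12) p.267] -/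
theorem bound312_eq (L : ℕ) (hL : L ≠ 0) (k : ℕ) (c β₀ B₃ εk : ℝ) :
    c * B₃ * (L : ℝ) ^ 2 * (1 + β₀) * εk * (((L : ℝ))⁻¹ * ((L : ℝ) ^ k)⁻¹) ^ 2
      = c * ((1 + β₀) * B₃ * εk) * (((L : ℝ) ^ k)⁻¹) ^ 2 := by
  have hL' : (L : ℝ) ≠ 0 := by exact_mod_cast hL
  field_simp

section Core

variable {𝔸 : Type*} [NormedRing 𝔸] [NormOneClass 𝔸] [NormedAlgebra ℂ 𝔸] [CompleteSpace 𝔸]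

/-- The Prop.-2 smallness `4(1+β₀)B₃ε_k ≤ c₂′(d, L) = 1/(512(d+1)(d+4)L²)` implies the Lemma-1 smallness
`4L²(1+β₀)B₃ε_k ≤ 1/(6(d+1))` of `B14Ineq313.Ineq313Printed` and the closure-radius smallness
`64(d+1)(d+4)L²(1+β₀)B₃ε_k ≤ 1/4` of a gauge group closed at radius `1/4` (`B7Prop2Explicit.AvgClosed`, e.g. the
unitary group of a C⋆-algebra). [cite: Balaban1988Convergent, (3.12)–(3.13) p.267] -/
theorem smallness_of_c2' {L : ℕ} (hL : 1 ≤ L) {α : ℝ} (h : 4 * α ≤ c2' d L) :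
    4 * (L : ℝ) ^ 2 * α ≤ 1 / (6 * ((d : ℝ) + 1)) ∧ 64 * ((d : ℝ) + 1) * (d + 4) * (L : ℝ) ^ 2 * α ≤ 1 / 4 := by
  have hLr : (1 : ℝ) ≤ L := by exact_mod_cast hL
  have hpos : (0 : ℝ) < 512 * ((d : ℝ) + 1) * (d + 4) * (L : ℝ) ^ 2 := by positivity
  have h1 : 4 * α ≤ 1 / (512 * ((d : ℝ) + 1) * (d + 4) * (L : ℝ) ^ 2) := h
  rw [le_div_iff₀ hpos] at h1
  refine ⟨?_, by linarith⟩
  rw [le_div_iff₀ (by positivity)]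
  have h2 : (0 : ℝ) ≤ (L : ℝ) ^ 2 * (6 * ((d : ℝ) + 1)) := by positivity
  -- `4L²α·6(d+1) = (4α·512(d+1)(d+4)L²)·6/(512(d+4)) ≤ 6/(512(d+4)) ≤ 1`
  nlinarith [mul_nonneg h2 (by positivity : (0 : ℝ) ≤ (d : ℝ) + 4), (Nat.cast_nonneg d : (0 : ℝ) ≤ d)]

/-! ## §2 (3.12) ⇒ the plaquette variables of `M^k(U)` are `2c(1+β₀)B₃ε_k`-close to `1` (Prop. 2 of [12]) -/

/-- **(3.12) ⇒ regularity of `V^{(k)} = M^k(U)`, by Proposition 2 (54) of [12]** (`prop2_explicit_at`), for a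
gauge group `G ⊂ {|u| ≤ 1, |u⁻¹| ≤ 1}` closed under (42) at radius `t`: `U` `G`-valued on `ηℤ^d ≅ ℤ^d`, `η = L^{−k}`,
`L ≥ 2`, (3.12) with coefficient `0 < c ≤ 2`, `sup_p |U(∂p) − 1| < cB₃L²(1+β₀)ε_k(L⁻¹η)²` (`c = 2`: `U_{k+1}`; `c = 1`:
`U_{k+1,□′}`), smallness (M3) ⟹ `sup_p |M^k(U)(∂p) − 1| < 2c(1+β₀)B₃ε_k` on the unit `k`-lattice, and every `M^j(U)`,
`j ≤ k`, is `G`-valued. [cite: Balaban1988Convergent, (3.12) p.267] -/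
theorem avgIter_pdev_lt_of_312 (L : ℕ) (hL : 2 ≤ L) {G : Subgroup 𝔸ˣ} {t : ℝ} (hG : AvgClosedAt d t L G)
    (k : ℕ) (U : Site d → Fin d → 𝔸ˣ) (hU : ∀ x κ, U x κ ∈ G) {β₀ B₃ εk c : ℝ} (hc0 : 0 < c) (hc2 : c ≤ 2)
    (hpos : 0 < (1 + β₀) * B₃ * εk) (hC : C0 d * (2 * ((1 + β₀) * B₃ * εk)) ≤ 1 / 3)
    (hc2' : 4 * ((1 + β₀) * B₃ * εk) ≤ c2' d L)
    (ht : 64 * ((d : ℝ) + 1) * (d + 4) * (L : ℝ) ^ 2 * ((1 + β₀) * B₃ * εk) ≤ t)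
    (h312 : pdev U < c * B₃ * (L : ℝ) ^ 2 * (1 + β₀) * εk * (((L : ℝ))⁻¹ * ((L : ℝ) ^ k)⁻¹) ^ 2) :
    pdev (avgIter L U k) < 2 * (c * ((1 + β₀) * B₃ * εk)) ∧ ∀ j ≤ k, ∀ x κ, avgIter L U j x κ ∈ G := by
  set α : ℝ := (1 + β₀) * B₃ * εk with hα
  rw [bound312_eq L (by omega)] at h312
  have hα0 : 0 < c * α := mul_pos hc0 hpos
  have hcα : c * α ≤ 2 * α := mul_le_mul_of_nonneg_right hc2 hpos.le
  have hC' : C0 d * (c * α) ≤ 1 / 3 := (mul_le_mul_of_nonneg_left hcα (C0_pos d).le).trans hC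
  have ht' : 32 * ((d : ℝ) + 1) * (d + 4) * (L : ℝ) ^ 2 * (c * α) ≤ t := by
    have h0 : (0 : ℝ) ≤ 32 * ((d : ℝ) + 1) * (d + 4) * (L : ℝ) ^ 2 := by positivity
    nlinarith [mul_le_mul_of_nonneg_left hcα h0]
  have h := prop2_explicit_at L hL hG k U hU hα0 hC' (by linarith) ht' h312
  exact ⟨h.1.trans (B7.prop2_bound_lt_two_alpha (C0 d) (c * α) hα0 hC'), h.2⟩

/-- **(3.12) ⇒ the fields `plaqV`/`plaqVbox` of `Hyp313`**: under the hypotheses of `avgIter_pdev_lt_of_312`,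
`M^k(U)` is `{|u| ≤ 1, |u⁻¹| ≤ 1}`-valued and its plaquette variables are `4(1+β₀)B₃ε_k`-close to `1` on every order
interval `[lo, hi]` of the unit `k`-lattice (`2c(1+β₀)B₃ε_k ≤ 4(1+β₀)B₃ε_k`). [cite: Balaban1988Convergent, (3.12)–(3.13) p.267] -/
theorem plaqSmall_avgIter_of_312 (L : ℕ) (hL : 2 ≤ L) {G : Subgroup 𝔸ˣ} {t : ℝ} (hG : AvgClosedAt d t L G)
    (k : ℕ) (U : Site d → Fin d → 𝔸ˣ) (hU : ∀ x κ, U x κ ∈ G) {β₀ B₃ εk c : ℝ} (hc0 : 0 < c) (hc2 : c ≤ 2)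
    (hpos : 0 < (1 + β₀) * B₃ * εk) (hC : C0 d * (2 * ((1 + β₀) * B₃ * εk)) ≤ 1 / 3)
    (hc2' : 4 * ((1 + β₀) * B₃ * εk) ≤ c2' d L)
    (ht : 64 * ((d : ℝ) + 1) * (d + 4) * (L : ℝ) ^ 2 * ((1 + β₀) * B₃ * εk) ≤ t)
    (h312 : pdev U < c * B₃ * (L : ℝ) ^ 2 * (1 + β₀) * εk * (((L : ℝ))⁻¹ * ((L : ℝ) ^ k)⁻¹) ^ 2) :
    (∀ x κ, avgIter L U k x κ ∈ U1 𝔸) ∧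
      ∀ lo hi : Site d, B8Lemma1NonAbelian.PlaqSmall (avgIter L U k) lo hi (4 * (1 + β₀) * B₃ * εk) := by
  obtain ⟨hlt, hmem⟩ := avgIter_pdev_lt_of_312 L hL hG k U hU hc0 hc2 hpos hC hc2' ht h312
  have hU1 : ∀ x κ, avgIter L U k x κ ∈ U1 𝔸 := fun x κ => hG.le_U1 (hmem k le_rfl x κ)
  have hcα : c * ((1 + β₀) * B₃ * εk) ≤ 2 * ((1 + β₀) * B₃ * εk) := mul_le_mul_of_nonneg_right hc2 hpos.le
  have hle : pdev (avgIter L U k) ≤ 4 * (1 + β₀) * B₃ * εk := by linarith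
  -- a (strict) bound on the supremum over `ℤ^d` is a plaquette bound on every order interval (`le_pdev`)
  exact ⟨hU1, fun lo hi x κ μ _ _ _ => (le_pdev hU1 x κ μ).trans hle⟩

/-! ## §3 The hypothesis block `Hyp313` of (3.13) built from (3.12), and (3.12) ⇒ (3.13) -/

/-- **`Hyp313` from (3.12).**  For `G`-valued `U = U_{k+1}`, `Ubox = U_{k+1,□′}` on `ηℤ^d ≅ ℤ^d`, `η = L^{−k}`,
satisfying (3.12) `sup_p |U(∂p) − 1| < 2B₃L²(1+β₀)ε_k(L⁻¹η)²` and its twin "with the coefficient 1", and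
`V = M^k(U) = V^{(k)}`, `Vbox = M^k(Ubox) = V^{(k)}_{□′}` (`avgIter`): if on the block pair `B(y) ∪ B(y + Le_κ)` of the
unit `k`-lattice the axial trees of `V`, `Vbox` agree (model (D1) of `B14Ineq313`) and their block averages agree
(printed: `M^{k+1}(U_{k+1}) = V_{k+1} = M^{k+1}(U_{k+1,□′})`), then `Hyp313 L V Vbox y κ (4(1+β₀)B₃ε_k)` — the fields
`plaqV`, `plaqVbox`, `memV`, `memVbox` now PROVED (Prop. 2 of [12]). [cite: Balaban1988Convergent, (3.12)–(3.13) p.267] -/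
theorem hyp313_of_312 (L : ℕ) (hL : 2 ≤ L) {G : Subgroup 𝔸ˣ} {t : ℝ} (hG : AvgClosedAt d t L G) (k : ℕ)
    (U Ubox : Site d → Fin d → 𝔸ˣ) (hU : ∀ x κ, U x κ ∈ G) (hUbox : ∀ x κ, Ubox x κ ∈ G) {β₀ B₃ εk : ℝ}
    (hpos : 0 < (1 + β₀) * B₃ * εk) (hC : C0 d * (2 * ((1 + β₀) * B₃ * εk)) ≤ 1 / 3)
    (hc2' : 4 * ((1 + β₀) * B₃ * εk) ≤ c2' d L)
    (ht : 64 * ((d : ℝ) + 1) * (d + 4) * (L : ℝ) ^ 2 * ((1 + β₀) * B₃ * εk) ≤ t)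
    (h312 : pdev U < 2 * B₃ * (L : ℝ) ^ 2 * (1 + β₀) * εk * (((L : ℝ))⁻¹ * ((L : ℝ) ^ k)⁻¹) ^ 2)
    (h312box : pdev Ubox < 1 * B₃ * (L : ℝ) ^ 2 * (1 + β₀) * εk * (((L : ℝ))⁻¹ * ((L : ℝ) ^ k)⁻¹) ^ 2)
    (y : Site d) (κ : Fin d)
    (axial : ∀ r : Fin d → Fin L, axialFn (avgIter L U k) y (y + boxVec L r)
      = axialFn (avgIter L Ubox k) y (y + boxVec L r))
    (axial₁ : ∀ r : Fin d → Fin L, axialFn (avgIter L U k) (y + (L : ℤ) • e κ) (y + (L : ℤ) • e κ + boxVec L r)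
      = axialFn (avgIter L Ubox k) (y + (L : ℤ) • e κ) (y + (L : ℤ) • e κ + boxVec L r))
    (avg : bavg L (avgIter L U k) y κ = bavg L (avgIter L Ubox k) y κ) :
    Hyp313 L (avgIter L U k) (avgIter L Ubox k) y κ (4 * (1 + β₀) * B₃ * εk) := by
  obtain ⟨hV, hPV⟩ := plaqSmall_avgIter_of_312 L hL hG k U hU (by norm_num : (0 : ℝ) < 2) le_rfl hpos hC hc2' ht
    h312
  obtain ⟨hVbox, hPVbox⟩ := plaqSmall_avgIter_of_312 L hL hG k Ubox hUbox (by norm_num : (0 : ℝ) < 1)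
    (by norm_num) hpos hC hc2' ht h312box
  exact
    { memV := hV
      memVbox := hVbox
      plaqV := hPV y (y + pairTop L κ)
      plaqVbox := hPVbox y (y + pairTop L κ)
      axial := axial
      axial₁ := axial₁
      avg := avg }

/-- **(3.12) ⇒ (3.13) p. 267** for the concrete `k`-fold average on `ℤ^d`: under the hypotheses of `hyp313_of_312`,
every bond `b` of the block pair `B(y) ∪ B(y + Le_κ)` has *"|V^{(k)} − V^{(k)}_{□′}| < (4dL)²(1+β₀)B₃ε_k"* in the
bondwise form `‖V^{(k)}_b (V^{(k)}_{□′,b})⁻¹ − 1‖ < (4dL)²(1+β₀)B₃ε_k` of `B14Ineq313` — the row's decl `Ineq313Printed d 𝔸`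
(PROVED by r11, Lemma 1 of [14]) applied to the `Hyp313` block built here, its Lemma-1 smallness
`4L²(1+β₀)B₃ε_k ≤ 1/(6(d+1))` being implied by `4(1+β₀)B₃ε_k ≤ c₂′`. [cite: Balaban1988Convergent, (3.13) p.267] -/
theorem ineq313_of_312 (L : ℕ) (hL : 2 ≤ L) {G : Subgroup 𝔸ˣ} {t : ℝ} (hG : AvgClosedAt d t L G) (k : ℕ)
    (U Ubox : Site d → Fin d → 𝔸ˣ) (hU : ∀ x κ, U x κ ∈ G) (hUbox : ∀ x κ, Ubox x κ ∈ G) {β₀ B₃ εk : ℝ}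
    (hpos : 0 < (1 + β₀) * B₃ * εk) (hC : C0 d * (2 * ((1 + β₀) * B₃ * εk)) ≤ 1 / 3)
    (hc2' : 4 * ((1 + β₀) * B₃ * εk) ≤ c2' d L)
    (ht : 64 * ((d : ℝ) + 1) * (d + 4) * (L : ℝ) ^ 2 * ((1 + β₀) * B₃ * εk) ≤ t)
    (h312 : pdev U < 2 * B₃ * (L : ℝ) ^ 2 * (1 + β₀) * εk * (((L : ℝ))⁻¹ * ((L : ℝ) ^ k)⁻¹) ^ 2)
    (h312box : pdev Ubox < 1 * B₃ * (L : ℝ) ^ 2 * (1 + β₀) * εk * (((L : ℝ))⁻¹ * ((L : ℝ) ^ k)⁻¹) ^ 2)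
    (y : Site d) (κ : Fin d)
    (axial : ∀ r : Fin d → Fin L, axialFn (avgIter L U k) y (y + boxVec L r)
      = axialFn (avgIter L Ubox k) y (y + boxVec L r))
    (axial₁ : ∀ r : Fin d → Fin L, axialFn (avgIter L U k) (y + (L : ℤ) • e κ) (y + (L : ℤ) • e κ + boxVec L r)
      = axialFn (avgIter L Ubox k) (y + (L : ℤ) • e κ) (y + (L : ℤ) • e κ + boxVec L r))
    (avg : bavg L (avgIter L U k) y κ = bavg L (avgIter L Ubox k) y κ)
    (x : Site d) (ν : Fin d) (hx : InPair L y κ x) (hxν : InPair L y κ (x + e ν)) :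
    ‖((pert (avgIter L U k) (avgIter L Ubox k) x ν : 𝔸ˣ) : 𝔸) - 1‖
      < (4 * (d : ℝ) * L) ^ 2 * (1 + β₀) * B₃ * εk :=
  have hL1 : 1 ≤ L := le_trans (by norm_num) hL
  Ineq313Printed_holds d 𝔸 L hL1 β₀ B₃ εk hpos (smallness_of_c2' hL1 hc2').1 _ _ y κ
    (hyp313_of_312 L hL hG k U Ubox hU hUbox hpos hC hc2' ht h312 h312box y κ axial axial₁ avg) x ν hx hxν

end Core

/-! ## §4 The printed locality "for `p ⊂ □′~`": (3.12) only for the `η`-plaquettes of the `k`-blocks over the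
`2L`-cube `y + [0, 2L)^d ⊃ B(y) ∪ B(y + Le_κ)` of the unit `k`-lattice ([12] p. 24 / p. 26 locality, tree
`B7Prop1Local`: "`Ū^k_c` depends only on `U_b` for `b ⊂ B^k(c₋) ∪ B^k(c₊)`", clamped extensions) -/

section Local

variable {𝔸 : Type*} [NormedRing 𝔸] [NormOneClass 𝔸] [NormedAlgebra ℂ 𝔸] [CompleteSpace 𝔸]

omit [NormOneClass 𝔸] in
/-- LOCALITY OF `M^k` ON A CUBE ([12] p. 24; `B7Prop1Local.avgIter_congr`): the `k`-fold average of the clamped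
extension (`clampCfg`) of `U` from a fine box `[lo′, hi′] ⊃ [L^k y, L^k(HI + 𝟙) − 𝟙]` (the `η`-bonds of the `k`-blocks
`B^k(x)`, `x ∈ [y, HI]`) agrees with `M^k(U)` on the bonds of the cube `[y, HI]`. [cite: Balaban1988Convergent, (3.12) p.267] -/
theorem avgIter_clampCfg_agreeOn (L : ℕ) (hL : 1 ≤ L) (k : ℕ) (U : Site d → Fin d → 𝔸ˣ) {y HI lo' hi' : Site d}
    (hlo : ∀ i, lo' i ≤ (L : ℤ) ^ k * y i) (hhi : ∀ i, (L : ℤ) ^ k * (HI i + 1) - 1 ≤ hi' i) :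
    AgreeOn y HI (avgIter L (clampCfg lo' hi' U) k) (avgIter L U k) := by
  intro x μ hx hxμ
  have hP : (0 : ℤ) ≤ (L : ℤ) ^ k := by positivity
  refine avgIter_congr L hL k x μ ((clampCfg_agree (lo := lo') (hi := hi') U).mono (fun i => ?_) (fun i => ?_))
  · exact (hlo i).trans (mul_le_mul_of_nonneg_left (hx i).1 hP)
  · have h1 : x i ≤ HI i := (hx i).2
    have h2 : (x + e μ) i ≤ HI i := (hxμ i).2
    rw [add_e_apply] at h2
    refine le_trans ?_ (hhi i)
    simp only [bondHiK]
    split_ifs at h2 ⊢ with hi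
    · linarith [mul_le_mul_of_nonneg_left (show x i + 2 ≤ HI i + 1 by omega) hP]
    · linarith [mul_le_mul_of_nonneg_left (show x i + 1 ≤ HI i + 1 by omega) hP]

/-- **(3.12) ⇒ (3.13) p. 267 WITH THE PRINTED LOCALITY** ("for `p ⊂ □′~`"; here block pair by block pair: (3.12)
for `U = U_{k+1}` and, with coefficient 1, for `Ubox = U_{k+1,□′}` over the `η`-plaquettes `p ⊂ [L^k y, L^k(y + 2L𝟙) − 𝟙]`
ONLY — the `k`-blocks under the `2L`-cube `y + [0, 2L)^d ⊃ B(y) ∪ B(y + Le_κ)` of the unit `k`-lattice, `⊂ □′~` —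
as `B7Prop1Local.pdevOn` bounds): with the agreement of axial trees and block averages on the pair and the smallness
(M3), `‖V^{(k)}_b (V^{(k)}_{□′,b})⁻¹ − 1‖ < (4dL)²(1+β₀)B₃ε_k` on every bond `b` of the pair.  Proof: the clamped
extensions of `U`, `Ubox` from the fine box satisfy (3.12) on all of `ℤ^d` (`pdev_clampCfg_le`), `ineq313_of_312` applies
to them, and their `k`-fold averages agree with `V^{(k)}`, `V^{(k)}_{□′}` on the `2L`-cube (`avgIter_clampCfg_agreeOn`),
which carries the axial trees, the averages `M^{k+1}` at `c = ⟨y, y + Le_κ⟩` (`bavg_congr`) and the bonds of the pair.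
[cite: Balaban1988Convergent, (3.12)–(3.13) p.267] -/
theorem ineq313_of_312_local (L : ℕ) (hL : 2 ≤ L) {G : Subgroup 𝔸ˣ} {t : ℝ} (hG : AvgClosedAt d t L G) (k : ℕ)
    (U Ubox : Site d → Fin d → 𝔸ˣ) (hU : ∀ x κ, U x κ ∈ G) (hUbox : ∀ x κ, Ubox x κ ∈ G) {β₀ B₃ εk : ℝ}
    (hpos : 0 < (1 + β₀) * B₃ * εk) (hC : C0 d * (2 * ((1 + β₀) * B₃ * εk)) ≤ 1 / 3)
    (hc2' : 4 * ((1 + β₀) * B₃ * εk) ≤ c2' d L)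
    (ht : 64 * ((d : ℝ) + 1) * (d + 4) * (L : ℝ) ^ 2 * ((1 + β₀) * B₃ * εk) ≤ t) (y : Site d) (κ : Fin d)
    (h312 : pdevOn (loK L k y) (fun i => (L : ℤ) ^ k * (y i + 2 * L) - 1) U
      < 2 * B₃ * (L : ℝ) ^ 2 * (1 + β₀) * εk * (((L : ℝ))⁻¹ * ((L : ℝ) ^ k)⁻¹) ^ 2)
    (h312box : pdevOn (loK L k y) (fun i => (L : ℤ) ^ k * (y i + 2 * L) - 1) Ubox
      < 1 * B₃ * (L : ℝ) ^ 2 * (1 + β₀) * εk * (((L : ℝ))⁻¹ * ((L : ℝ) ^ k)⁻¹) ^ 2)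
    (axial : ∀ r : Fin d → Fin L, axialFn (avgIter L U k) y (y + boxVec L r)
      = axialFn (avgIter L Ubox k) y (y + boxVec L r))
    (axial₁ : ∀ r : Fin d → Fin L, axialFn (avgIter L U k) (y + (L : ℤ) • e κ) (y + (L : ℤ) • e κ + boxVec L r)
      = axialFn (avgIter L Ubox k) (y + (L : ℤ) • e κ) (y + (L : ℤ) • e κ + boxVec L r))
    (avg : bavg L (avgIter L U k) y κ = bavg L (avgIter L Ubox k) y κ)
    (x : Site d) (ν : Fin d) (hx : InPair L y κ x) (hxν : InPair L y κ (x + e ν)) :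
    ‖((pert (avgIter L U k) (avgIter L Ubox k) x ν : 𝔸ˣ) : 𝔸) - 1‖
      < (4 * (d : ℝ) * L) ^ 2 * (1 + β₀) * B₃ * εk := by
  have hL1 : 1 ≤ L := le_trans (by norm_num) hL
  have hP1 : (1 : ℤ) ≤ (L : ℤ) ^ k := one_le_pow₀ (by exact_mod_cast hL1)
  -- the fine box `[L^k y, L^k (y + 2L𝟙) − 𝟙]` and the clamped extensions
  set lo' : Site d := loK L k y with hlo'
  set hi' : Site d := fun i => (L : ℤ) ^ k * (y i + 2 * L) - 1 with hhi'
  have hlohi : ∀ i, lo' i ≤ hi' i := fun i => by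
    have h1 : (1 : ℤ) ≤ (L : ℤ) ^ k * (2 * L) := one_le_mul_of_one_le_of_one_le hP1 (by omega)
    show (L : ℤ) ^ k * y i ≤ (L : ℤ) ^ k * (y i + 2 * L) - 1
    linarith [mul_add ((L : ℤ) ^ k) (y i) (2 * L)]
  have hUU1 : ∀ x κ, U x κ ∈ U1 𝔸 := fun x κ => hG.le_U1 (hU x κ)
  have hUboxU1 : ∀ x κ, Ubox x κ ∈ U1 𝔸 := fun x κ => hG.le_U1 (hUbox x κ)
  have hU' : ∀ x κ, clampCfg lo' hi' U x κ ∈ G := clampCfg_mem hU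
  have hUbox' : ∀ x κ, clampCfg lo' hi' Ubox x κ ∈ G := clampCfg_mem hUbox
  have h312' := (pdev_clampCfg_le hlohi hUU1).trans_lt h312
  have h312box' := (pdev_clampCfg_le hlohi hUboxU1).trans_lt h312box
  -- the `k`-fold averages of the clamped fields agree with `V^{(k)}`, `V^{(k)}_{□′}` on the `2L`-cube `[y, y + (2L−1)𝟙]`
  have hHI : ∀ i, (L : ℤ) ^ k * ((fun i => y i + (2 * L - 1)) i + 1) - 1 ≤ hi' i := fun i => by
    show (L : ℤ) ^ k * (y i + (2 * L - 1) + 1) - 1 ≤ (L : ℤ) ^ k * (y i + 2 * L) - 1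
    exact le_of_eq (by ring)
  have hA : AgreeOn y (fun i => y i + (2 * L - 1)) (avgIter L (clampCfg lo' hi' U) k) (avgIter L U k) :=
    avgIter_clampCfg_agreeOn L hL1 k U (fun i => by rw [hlo']; exact le_rfl) hHI
  have hAbox : AgreeOn y (fun i => y i + (2 * L - 1)) (avgIter L (clampCfg lo' hi' Ubox) k) (avgIter L Ubox k) :=
    avgIter_clampCfg_agreeOn L hL1 k Ubox (fun i => by rw [hlo']; exact le_rfl) hHI
  -- the points of the pair `B(y) ∪ B(y + Le_κ)` lie in the cube `[y, y + (2L−1)𝟙]`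
  have inBox_of_inPair : ∀ z, InPair L y κ z → InBox y (fun i => y i + (2 * L - 1)) z := by
    rintro z (h | h) i <;> change y i ≤ z i ∧ z i ≤ y i + (2 * L - 1) <;> have := h i
    · constructor <;> omega
    · rw [add_zsmul_e_apply] at this
      split_ifs at this <;> constructor <;> omega
  have hblk : ∀ z : Site d, InBlock L z z := fun z i => ⟨le_rfl, by omega⟩
  have hy := inBox_of_inPair y (Or.inl (hblk y))
  have hyL := inBox_of_inPair _ (Or.inr (hblk (y + (L : ℤ) • e κ)))
  have hyr : ∀ r : Fin d → Fin L, InBox y (fun i => y i + (2 * L - 1)) (y + boxVec L r) := fun r =>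
    inBox_of_inPair _ (Or.inl ((inBlock_iff L y _).2 ⟨r, rfl⟩))
  have hyLr : ∀ r : Fin d → Fin L, InBox y (fun i => y i + (2 * L - 1)) (y + (L : ℤ) • e κ + boxVec L r) :=
    fun r => inBox_of_inPair _ (Or.inr ((inBlock_iff L _ _).2 ⟨r, rfl⟩))
  -- transfer of the axial trees and the block averages to the clamped fields
  have key : ∀ (W : Site d → Fin d → 𝔸ˣ) (p : Site d) (r : Fin d → Fin L),
      axialFn W p (p + boxVec L r) = hol W p (treeWord (boxVec L r)) := fun W p r => by
    show hol W p (treeWord (p + boxVec L r - p)) = _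
    rw [add_sub_cancel_left]
  have axial' : ∀ r : Fin d → Fin L, axialFn (avgIter L (clampCfg lo' hi' U) k) y (y + boxVec L r)
      = axialFn (avgIter L (clampCfg lo' hi' Ubox) k) y (y + boxVec L r) := fun r => by
    rw [key, key, hol_treeWord_congr hA y _ hy (hyr r), hol_treeWord_congr hAbox y _ hy (hyr r), ← key, ← key]
    exact axial r
  have axial₁' : ∀ r : Fin d → Fin L,
      axialFn (avgIter L (clampCfg lo' hi' U) k) (y + (L : ℤ) • e κ) (y + (L : ℤ) • e κ + boxVec L r)
        = axialFn (avgIter L (clampCfg lo' hi' Ubox) k) (y + (L : ℤ) • e κ) (y + (L : ℤ) • e κ + boxVec L r) :=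
    fun r => by
    rw [key, key, hol_treeWord_congr hA _ _ hyL (hyLr r), hol_treeWord_congr hAbox _ _ hyL (hyLr r), ← key,
      ← key]
    exact axial₁ r
  have hbondHi : ∀ i, bondHi L y κ i ≤ (fun i => y i + (2 * L - 1)) i := fun i => by
    show bondHi L y κ i ≤ y i + (2 * L - 1)
    simp only [bondHi]; split_ifs <;> omega
  have avg' : bavg L (avgIter L (clampCfg lo' hi' U) k) y κ = bavg L (avgIter L (clampCfg lo' hi' Ubox) k) y κ := by
    rw [bavg_congr L hL1 y κ (hA.mono (fun i => le_rfl) hbondHi),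
      bavg_congr L hL1 y κ (hAbox.mono (fun i => le_rfl) hbondHi)]
    exact avg
  -- (3.13) for the clamped fields, and transfer of the bond `(x, ν)` of the pair
  have hb := ineq313_of_312 L hL hG k _ _ hU' hUbox' hpos hC hc2' ht h312' h312box' y κ axial' axial₁' avg' x ν
    hx hxν
  have e1 := hA x ν (inBox_of_inPair x hx) (inBox_of_inPair _ hxν)
  have e2 := hAbox x ν (inBox_of_inPair x hx) (inBox_of_inPair _ hxν)
  have hpert : pert (avgIter L U k) (avgIter L Ubox k) x ν
      = pert (avgIter L (clampCfg lo' hi' U) k) (avgIter L (clampCfg lo' hi' Ubox) k) x ν := by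
    simp only [pert, e1, e2]
  rw [hpert]
  exact hb

end Local

/-! ## §5 The paper's gauge groups: `U(N)` (the unitary group of a C⋆-algebra) and `SU(N)` -/

section Unitary

variable {𝔸 : Type*} [CStarAlgebra 𝔸] [Nontrivial 𝔸]

/-- **(3.12) ⇒ (3.13) for unitary configurations** (`G` = the unitary group of a non-trivial C⋆-algebra, e.g.
`U(N) ⊂ M_N(ℂ)` with the operator norm; `B7Prop2Explicit.avgClosed_unitaryUnits`, radius `1/4`): `ineq313_of_312` with
the closure-radius smallness discharged by `4(1+β₀)B₃ε_k ≤ c₂′` (`smallness_of_c2'`). [cite: Balaban1988Convergent, (3.13) p.267] -/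
theorem ineq313_of_312_unitary (L : ℕ) (hL : 2 ≤ L) (k : ℕ) (U Ubox : Site d → Fin d → 𝔸ˣ)
    (hU : ∀ x κ, U x κ ∈ unitaryUnits 𝔸) (hUbox : ∀ x κ, Ubox x κ ∈ unitaryUnits 𝔸) {β₀ B₃ εk : ℝ}
    (hpos : 0 < (1 + β₀) * B₃ * εk) (hC : C0 d * (2 * ((1 + β₀) * B₃ * εk)) ≤ 1 / 3)
    (hc2' : 4 * ((1 + β₀) * B₃ * εk) ≤ c2' d L)
    (h312 : pdev U < 2 * B₃ * (L : ℝ) ^ 2 * (1 + β₀) * εk * (((L : ℝ))⁻¹ * ((L : ℝ) ^ k)⁻¹) ^ 2)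
    (h312box : pdev Ubox < 1 * B₃ * (L : ℝ) ^ 2 * (1 + β₀) * εk * (((L : ℝ))⁻¹ * ((L : ℝ) ^ k)⁻¹) ^ 2)
    (y : Site d) (κ : Fin d)
    (axial : ∀ r : Fin d → Fin L, axialFn (avgIter L U k) y (y + boxVec L r)
      = axialFn (avgIter L Ubox k) y (y + boxVec L r))
    (axial₁ : ∀ r : Fin d → Fin L, axialFn (avgIter L U k) (y + (L : ℤ) • e κ) (y + (L : ℤ) • e κ + boxVec L r)
      = axialFn (avgIter L Ubox k) (y + (L : ℤ) • e κ) (y + (L : ℤ) • e κ + boxVec L r))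
    (avg : bavg L (avgIter L U k) y κ = bavg L (avgIter L Ubox k) y κ)
    (x : Site d) (ν : Fin d) (hx : InPair L y κ x) (hxν : InPair L y κ (x + e ν)) :
    ‖((pert (avgIter L U k) (avgIter L Ubox k) x ν : 𝔸ˣ) : 𝔸) - 1‖
      < (4 * (d : ℝ) * L) ^ 2 * (1 + β₀) * B₃ * εk :=
  ineq313_of_312 L hL (avgClosedAt_of_avgClosed (avgClosed_unitaryUnits d L) le_rfl) k U Ubox hU hUbox hpos hC
    hc2' (smallness_of_c2' (le_trans (by norm_num) hL) hc2').2 h312 h312box y κ axial axial₁ avg x ν hx hxν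

end Unitary

section SpecialUnitary

variable {n : Type*} [Fintype n] [DecidableEq n] [Nonempty n]

open scoped Matrix.Norms.L2Operator

/-- **(3.12) ⇒ the plaquette smallness of `M^k(U)` for `SU(N)`-valued configurations** (`G = SU(N) ⊂ M_N(ℂ)`,
operator norm; `B7Prop2SpecialUnitary.avgClosedAt_specialUnitary`): `plaqSmall_avgIter_of_312` with the closure radius
discharged by the one `G`-dependent smallness `N·64(d+1)(d+4)L²(1+β₀)B₃ε_k < π`; `ineq313_of_312(_local)` then apply
verbatim with this `G`. [cite: Balaban1988Convergent, (3.12)–(3.13) p.267] -/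
theorem plaqSmall_avgIter_of_312_specialUnitary (L : ℕ) (hL : 2 ≤ L) (k : ℕ)
    (U : Site d → Fin d → (Matrix n n ℂ)ˣ) (hU : ∀ x κ, U x κ ∈ specialUnitaryUnits n) {β₀ B₃ εk c : ℝ}
    (hc0 : 0 < c) (hc2 : c ≤ 2) (hpos : 0 < (1 + β₀) * B₃ * εk) (hC : C0 d * (2 * ((1 + β₀) * B₃ * εk)) ≤ 1 / 3)
    (hc2' : 4 * ((1 + β₀) * B₃ * εk) ≤ c2' d L)
    (hN : Fintype.card n * (64 * ((d : ℝ) + 1) * (d + 4) * (L : ℝ) ^ 2 * ((1 + β₀) * B₃ * εk)) < Real.pi)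
    (h312 : pdev U < c * B₃ * (L : ℝ) ^ 2 * (1 + β₀) * εk * (((L : ℝ))⁻¹ * ((L : ℝ) ^ k)⁻¹) ^ 2) :
    (∀ j ≤ k, ∀ x κ, avgIter L U j x κ ∈ specialUnitaryUnits n) ∧
      ∀ lo hi : Site d, B8Lemma1NonAbelian.PlaqSmall (avgIter L U k) lo hi (4 * (1 + β₀) * B₃ * εk) := by
  letI : CStarAlgebra (Matrix n n ℂ) := {}
  have hL1 : 1 ≤ L := le_trans (by norm_num) hL
  have hG := avgClosedAt_specialUnitary d L (smallness_of_c2' (d := d) hL1 hc2').2 hN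
  exact ⟨(avgIter_pdev_lt_of_312 L hL hG k U hU hc0 hc2 hpos hC hc2' le_rfl h312).2,
    (plaqSmall_avgIter_of_312 L hL hG k U hU hc0 hc2 hpos hC hc2' le_rfl h312).2⟩

end SpecialUnitary

-- Axiom audit (scratch, not shipped): `#print axioms` of `ineq313_of_312_local`, `ineq313_of_312_unitary`,
-- `plaqSmall_avgIter_of_312_specialUnitary` = [propext, Classical.choice, Quot.sound].

end Literature.MathematicalPhysics.QuantumFieldTheory.Balaban1983to89.B14Hyp313Discharge
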